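import Summits.Ventures.LatticeQCDFlow.Exactness.FlowSamplerSquareIntegrableCeiling
import Summits.Ventures.LatticeQCDFlow.Exactness.ReversibleVariationalCeilingPositive
import Summits.Ventures.LatticeQCDFlow.Exactness.IMHDirichletForm
import HarnessLib

/-!
# The acceptance-weighted ceiling on `L²(e^{−S})`: `τ_int(g) ≤ E_{g²}[1/ρ]/ā − ½` for EVERY square-integrable observable of the exact flow sampler

HONEST FRAMING: exact (Metropolis-corrected) sampling algorithms for lattice gauge theory;
figures of merit are autocorrelation/cost numbers at stated couplings and volumes; no
continuum-physics claim.  (SCALAR calibration rung S0-A: not a gauge result.)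

Venture `LatticeQCDFlow` (cell pub-lqcd), topic `Exactness`; FANOUT row 2 (`s0-phi4`, FLOW arm:
independence Metropolis `K = imhOp μ w q̃`).  NEW WORK of the cell — row 2's leftover (α⁹): the
bounded-observable ceiling `IMHTauIntLeAcceptanceCeiling` re-proved on the class of measurable
SQUARE-INTEGRABLE observables (the magnetisation `M = Σ_x φ_x` of lattice φ⁴ is unbounded), over
`FlowSamplerSquareIntegrable{,Contraction,Positive,Monotone,Ceiling}` (the flow sampler as a positive
self-adjoint contraction of all of `L²(w)`, its Dirichlet form `𝓔(v) = ½∫∫ s (v − v')²`),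
`IMHDirichletForm` (the rank-one minorant `s(t,t') ≥ ρ(t)ρ(t')w(t)w(t')/Z`) and the format-level
`RevOp.tauInt_le_of_forall_sq_inner_le_dirichlet_of_nonneg` (`ReversibleVariationalCeilingPositive`:
a variational bound caps every partial Green–Kubo sum of a positive sampler).  Nothing is cited as a
fact.  Printed counterpart NAMED ONLY: Deligiannidis–Lee 2018 (*Which ergodic averages have finite
asymptotic variance?*, Ann. Appl. Probab. 28), §3: `var(f, P) ≤ 2π̃(f²/ρ²) − π(f²)` for the
independence sampler via its jump chain [corpus: paper:arxiv-1606.08373 p.8]; the route here is the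
tree's elementary one (rank-one minorant + weighted Cauchy–Schwarz + partial Neumann sums).

## What is proved (general `(X, μ)` s-finite; `w > 0` measurable integrable, `Z = ∫ w`; `q > 0`
measurable integrable, `∫ q = 1`; `ρ(t) = 1 − λ(b(t))` the acceptance probability from `t`
(`b = w/q`, `λ = rejCurve`), `P_ρ = ∫ ρ w = ā Z`; "square-integrable" = measurable with `∫ v² w < ∞`)

* `acc_facts`, `acc_mul_weight_integral_pos` — `ρ` is measurable, `0 < ρ ≤ 1`, `P_ρ > 0`;
  `integrable_acc_mul_weight_mul_of_sq` / `_of_abs` — `ρ w v²`, `ρ w v ∈ L¹` for square-integrable `v`;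
* **`dirichlet_ge_rankOne_of_sq`** — for every square-integrable `v`:
  `(P_ρ/Z) ∫ ρ w v² − (∫ ρ w v)²/Z ≤ 𝓔(v)` (the bounded-class `dirichlet_ge` on `L²(w)`);
* **`sq_inner_le_acceptance_mul_dirichlet_of_sq`** — for square-integrable CENTRED `g` (`∫ g w = 0`)
  with `G₂ = ∫ g² w/ρ < ∞` and every square-integrable `v`:
  `(∫ g v w)² ≤ G₂ · (Z/P_ρ) · 𝓔(v)` (weighted Cauchy–Schwarz against the `ρw`-centred trial);
* **`imhOp_sum_range_autocov_le_acceptanceCeiling_of_sq`** — EVERY partial sum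
  `Σ_{k<N} C_g(k) ≤ G₂ Z/P_ρ`;
* **`imhOp_tauInt_le_acceptanceCeiling_of_sq`** — with `P = ∫ g² w > 0`: the normalised
  autocorrelation series of `g` IS SUMMABLE and **`τ_int(g) ≤ (G₂/P)/(P_ρ/Z) − ½ = E_{g²w}[1/ρ]/ā − ½`**
  — no boundedness of `g`, no a-priori summability, no weight bound;
Lattice instances (every polynomial observable of lattice φ⁴ under row 2's `imhOpPhi4`, the
magnetisation) and a sufficient condition for `G₂ < ∞` for unbounded `g` (`W₂ = ∫ b w < ∞` and
`∫ g² b w < ∞`) are `Phi4FlowSquareIntegrableAcceptanceCeiling.lean`.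
NOT CLAIMED: any value of `ā`, `G₂`, `W₂` for any run or trained network (measured columns /
hypotheses); sharpness; anything for the HMC / local arms.
-/

namespace Summit.Ventures.LatticeQCDFlow.Exactness

open Real MeasureTheory Filter Finset Set
open Summit.Ventures.LatticeQCDFlow.Scoring

section General

variable {X : Type*} [MeasurableSpace X] {μ : Measure X} [SFinite μ] {w q : X → ℝ}

/-! ## §1 The acceptance function `ρ` on `L²(w)` -/

/-- `ρ = 1 − λ ∘ b` is measurable with `0 < ρ(t) ≤ 1`. -/
theorem acc_facts (hw0 : ∀ t, 0 < w t) (hwm : Measurable w) (hwi : Integrable w μ)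
    (hq0 : ∀ t, 0 < q t) (hqm : Measurable q) (hqi : Integrable q μ) (hq1 : ∫ z, q z ∂μ = 1) :
    Measurable (fun t => 1 - rejCurve μ w q (w t / q t)) ∧
    ∀ t, 0 < 1 - rejCurve μ w q (w t / q t) ∧ 1 - rejCurve μ w q (w t / q t) ≤ 1 :=
  ⟨measurable_const.sub ((measurable_rejCurve hwm hqm).comp (hwm.div hqm)), fun t =>
    ⟨(acc_mul_weight_le hw0 hwm hwi hq0 hqm hqi hq1 t).2.1,
      (acc_mul_weight_le hw0 hwm hwi hq0 hqm hqi hq1 t).2.2⟩⟩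

/-- `ρ w ∈ L¹` and `P_ρ = ∫ ρ w > 0` (the equilibrium acceptance `ā = P_ρ/Z` is positive). -/
theorem acc_mul_weight_integral_pos (hw0 : ∀ t, 0 < w t) (hwm : Measurable w)
    (hwi : Integrable w μ) (hq0 : ∀ t, 0 < q t) (hqm : Measurable q) (hqi : Integrable q μ)
    (hq1 : ∫ z, q z ∂μ = 1) :
    Integrable (fun t => (1 - rejCurve μ w q (w t / q t)) * w t) μ ∧
    0 < ∫ t, (1 - rejCurve μ w q (w t / q t)) * w t ∂μ := by
  obtain ⟨hρm, hρ⟩ := acc_facts hw0 hwm hwi hq0 hqm hqi hq1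
  have i0 : Integrable (fun t => (1 - rejCurve μ w q (w t / q t)) * w t) μ := by
    refine Integrable.mono' hwi (hρm.mul hwm).aestronglyMeasurable (Eventually.of_forall fun t => ?_)
    obtain ⟨h0, h1⟩ := hρ t
    rw [Real.norm_eq_abs, abs_mul, abs_of_pos h0, abs_of_pos (hw0 t)]
    calc (1 - rejCurve μ w q (w t / q t)) * w t ≤ 1 * w t := mul_le_mul_of_nonneg_right h1 (hw0 t).le
      _ = w t := one_mul _
  exact ⟨i0, integral_pos_of_pos (fun t => mul_pos (hρ t).1 (hw0 t)) i0 hq1⟩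

/-- `ρ w f h ∈ L¹` for square-integrable `f, h` (`0 < ρ ≤ 1` and (int) on the class). -/
theorem integrable_acc_mul_weight_mul_of_sq (hw0 : ∀ t, 0 < w t) (hwm : Measurable w)
    (hwi : Integrable w μ) (hq0 : ∀ t, 0 < q t) (hqm : Measurable q) (hqi : Integrable q μ)
    (hq1 : ∫ z, q z ∂μ = 1) {f h : X → ℝ} (hfm : Measurable f) (hhm : Measurable h)
    (hf2 : Integrable (fun t => f t ^ 2 * w t) μ) (hh2 : Integrable (fun t => h t ^ 2 * w t) μ) :
    Integrable (fun t => (1 - rejCurve μ w q (w t / q t)) * w t * (f t * h t)) μ := by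
  obtain ⟨hρm, hρ⟩ := acc_facts hw0 hwm hwi hq0 hqm hqi hq1
  have hfh := (integrable_mul_mul_weight_of_sq (fun t => (hw0 t).le) hwm hfm hhm hf2 hh2).abs
  refine Integrable.mono' hfh ((hρm.mul hwm).mul (hfm.mul hhm)).aestronglyMeasurable
    (Eventually.of_forall fun t => ?_)
  obtain ⟨h0, h1⟩ := hρ t
  rw [Real.norm_eq_abs]
  show |(1 - rejCurve μ w q (w t / q t)) * w t * (f t * h t)| ≤ |f t * h t * w t|
  calc |(1 - rejCurve μ w q (w t / q t)) * w t * (f t * h t)|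
      = (1 - rejCurve μ w q (w t / q t)) * w t * |f t * h t| := by
        rw [abs_mul ((1 - rejCurve μ w q (w t / q t)) * w t) (f t * h t),
          abs_of_pos (mul_pos h0 (hw0 t))]
    _ ≤ 1 * w t * |f t * h t| :=
        mul_le_mul_of_nonneg_right (mul_le_mul_of_nonneg_right h1 (hw0 t).le) (abs_nonneg _)
    _ = |f t * h t * w t| := by
        rw [abs_mul (f t * h t) (w t), abs_of_pos (hw0 t)]; ring

/-- `ρ w f ∈ L¹` for square-integrable `f` (`|f| w ∈ L¹`). -/
theorem integrable_acc_mul_weight_mul_of_abs (hw0 : ∀ t, 0 < w t) (hwm : Measurable w)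
    (hwi : Integrable w μ) (hq0 : ∀ t, 0 < q t) (hqm : Measurable q) (hqi : Integrable q μ)
    (hq1 : ∫ z, q z ∂μ = 1) {f : X → ℝ} (hfm : Measurable f)
    (hf2 : Integrable (fun t => f t ^ 2 * w t) μ) :
    Integrable (fun t => (1 - rejCurve μ w q (w t / q t)) * w t * f t) μ := by
  obtain ⟨hρm, hρ⟩ := acc_facts hw0 hwm hwi hq0 hqm hqi hq1
  have hfw := (integrable_mul_weight_of_sq (fun t => (hw0 t).le) hwm hwi hfm hf2).abs
  refine Integrable.mono' hfw ((hρm.mul hwm).mul hfm).aestronglyMeasurable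
    (Eventually.of_forall fun t => ?_)
  obtain ⟨h0, h1⟩ := hρ t
  rw [Real.norm_eq_abs]
  show |(1 - rejCurve μ w q (w t / q t)) * w t * f t| ≤ |f t * w t|
  calc |(1 - rejCurve μ w q (w t / q t)) * w t * f t|
      = (1 - rejCurve μ w q (w t / q t)) * w t * |f t| := by
        rw [abs_mul ((1 - rejCurve μ w q (w t / q t)) * w t) (f t),
          abs_of_pos (mul_pos h0 (hw0 t))]
    _ ≤ 1 * w t * |f t| :=
        mul_le_mul_of_nonneg_right (mul_le_mul_of_nonneg_right h1 (hw0 t).le) (abs_nonneg _)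
    _ = |f t * w t| := by
        rw [abs_mul (f t) (w t), abs_of_pos (hw0 t)]; ring

/-! ## §2 The rank-one lower bound on the Dirichlet form, on `L²(w)` -/

/-- **POINCARÉ-TYPE LOWER BOUND ON THE DIRICHLET FORM, on `L²(w)`**: for every measurable
square-integrable `v`,  `(P_ρ/Z) ∫ ρ w v² − (∫ ρ w v)²/Z ≤ ∫ v² w − ∫ v (K v) w`
(`P_ρ = ∫ ρ w`; the rank-one minorant `s ≥ ρρ'ww'/Z` integrated against `(v − v')²`). -/
theorem dirichlet_ge_rankOne_of_sq (hw0 : ∀ t, 0 < w t) (hwm : Measurable w)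
    (hwi : Integrable w μ) (hq0 : ∀ t, 0 < q t) (hqm : Measurable q) (hqi : Integrable q μ)
    (hq1 : ∫ z, q z ∂μ = 1) {v : X → ℝ} (hvm : Measurable v)
    (hv2 : Integrable (fun t => v t ^ 2 * w t) μ) :
    ((∫ t, (1 - rejCurve μ w q (w t / q t)) * w t ∂μ) / (∫ z, w z ∂μ))
        * (∫ t, (1 - rejCurve μ w q (w t / q t)) * w t * v t ^ 2 ∂μ)
      - (∫ t, (1 - rejCurve μ w q (w t / q t)) * w t * v t ∂μ) ^ 2 / (∫ z, w z ∂μ)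
      ≤ (∫ t, v t ^ 2 * w t ∂μ) - ∫ t, v t * imhOp μ w q v t * w t ∂μ := by
  set Z : ℝ := ∫ z, w z ∂μ with hZdef
  have hZ : 0 < Z := integral_pos_of_pos hw0 hwi hq1
  set ρ : X → ℝ := fun t => 1 - rejCurve μ w q (w t / q t) with hρdef
  obtain ⟨hρm, hρ⟩ := acc_facts hw0 hwm hwi hq0 hqm hqi hq1
  rw [dirichlet_eq_half_sq_of_sq hw0 hwm hwi hq0 hqm hqi hq1 hvm hv2]
  -- one-variable pieces `ρ w`, `ρ w v`, `ρ w v²`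
  have i0 : Integrable (fun t => ρ t * w t) μ := (acc_mul_weight_integral_pos hw0 hwm hwi hq0 hqm hqi hq1).1
  have i1 : Integrable (fun t => ρ t * w t * v t) μ :=
    integrable_acc_mul_weight_mul_of_abs hw0 hwm hwi hq0 hqm hqi hq1 hvm hv2
  have i2 : Integrable (fun t => ρ t * w t * v t ^ 2) μ :=
    (integrable_acc_mul_weight_mul_of_sq hw0 hwm hwi hq0 hqm hqi hq1 hvm hvm hv2 hv2).congr
      (Eventually.of_forall fun t => by
        show (1 - rejCurve μ w q (w t / q t)) * w t * (v t * v t) = ρ t * w t * v t ^ 2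
        rw [sq])
  set Pρ : ℝ := ∫ t, ρ t * w t ∂μ with hPρ
  set M₁ : ℝ := ∫ t, ρ t * w t * v t ∂μ with hM₁
  set M₂ : ℝ := ∫ t, ρ t * w t * v t ^ 2 ∂μ with hM₂
  -- the rank-one double integral
  have hAA : Integrable (fun p : X × X => (ρ p.1 * w p.1 * v p.1 ^ 2) * (ρ p.2 * w p.2)) (μ.prod μ) :=
    i2.mul_prod i0
  have hBB : Integrable (fun p : X × X => (ρ p.1 * w p.1) * (ρ p.2 * w p.2 * v p.2 ^ 2)) (μ.prod μ) :=
    i0.mul_prod i2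
  have hCC : Integrable (fun p : X × X => (ρ p.1 * w p.1 * v p.1) * (ρ p.2 * w p.2 * v p.2))
      (μ.prod μ) := i1.mul_prod i1
  have hL : Integrable (fun p : X × X =>
      ρ p.1 * ρ p.2 * w p.1 * w p.2 / Z * (v p.1 - v p.2) ^ 2) (μ.prod μ) := by
    refine (((hAA.add hBB).sub (hCC.const_mul 2)).const_mul (1 / Z)).congr
      (Eventually.of_forall fun p => ?_)
    show 1 / Z * ((ρ p.1 * w p.1 * v p.1 ^ 2) * (ρ p.2 * w p.2)
        + (ρ p.1 * w p.1) * (ρ p.2 * w p.2 * v p.2 ^ 2)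
        - 2 * ((ρ p.1 * w p.1 * v p.1) * (ρ p.2 * w p.2 * v p.2)))
      = ρ p.1 * ρ p.2 * w p.1 * w p.2 / Z * (v p.1 - v p.2) ^ 2
    field_simp
    ring
  have hR : Integrable (fun p : X × X => imhFlow w q p.1 p.2 * (v p.1 - v p.2) ^ 2) (μ.prod μ) := by
    have hA : Integrable (fun p : X × X => imhFlow w q p.1 p.2 * v p.1 ^ 2) (μ.prod μ) :=
      integrable_imhFlow_mul_fst hw0 hwm hq0 hqm hqi (hvm.pow_const 2) hv2
    have hB : Integrable (fun p : X × X => imhFlow w q p.1 p.2 * v p.2 ^ 2) (μ.prod μ) :=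
      integrable_imhFlow_mul_snd hw0 hwm hq0 hqm hqi (hvm.pow_const 2) hv2
    have hAB := integrable_imhFlow_mul_mul_of_sq hw0 hwm hq0 hqm hqi hvm hvm hv2 hv2
    refine ((hA.add hB).sub (hAB.const_mul 2)).congr (Eventually.of_forall fun p => ?_)
    show imhFlow w q p.1 p.2 * v p.1 ^ 2 + imhFlow w q p.1 p.2 * v p.2 ^ 2
      - 2 * (imhFlow w q p.1 p.2 * v p.2 * v p.1) = imhFlow w q p.1 p.2 * (v p.1 - v p.2) ^ 2
    ring
  have hmono : ∫ p, ρ p.1 * ρ p.2 * w p.1 * w p.2 / Z * (v p.1 - v p.2) ^ 2 ∂(μ.prod μ)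
      ≤ ∫ p, imhFlow w q p.1 p.2 * (v p.1 - v p.2) ^ 2 ∂(μ.prod μ) :=
    integral_mono hL hR fun p => mul_le_mul_of_nonneg_right
      (imhFlow_ge_rankOne hw0 hwm hwi hq0 hqm hqi hq1 p.1 p.2) (sq_nonneg _)
  have hval : ∫ p, ρ p.1 * ρ p.2 * w p.1 * w p.2 / Z * (v p.1 - v p.2) ^ 2 ∂(μ.prod μ)
      = 2 * (Pρ * M₂ - M₁ ^ 2) / Z := by
    have e : ∀ p : X × X, ρ p.1 * ρ p.2 * w p.1 * w p.2 / Z * (v p.1 - v p.2) ^ 2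
        = 1 / Z * ((ρ p.1 * w p.1 * v p.1 ^ 2) * (ρ p.2 * w p.2)
          + (ρ p.1 * w p.1) * (ρ p.2 * w p.2 * v p.2 ^ 2)
          - 2 * ((ρ p.1 * w p.1 * v p.1) * (ρ p.2 * w p.2 * v p.2))) := fun p => by
      field_simp
      ring
    simp_rw [e]
    have hS : Integrable (fun p : X × X => (ρ p.1 * w p.1 * v p.1 ^ 2) * (ρ p.2 * w p.2)
        + (ρ p.1 * w p.1) * (ρ p.2 * w p.2 * v p.2 ^ 2)) (μ.prod μ) := hAA.add hBB
    have hC2 : Integrable (fun p : X × X => 2 * ((ρ p.1 * w p.1 * v p.1) * (ρ p.2 * w p.2 * v p.2)))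
        (μ.prod μ) := hCC.const_mul 2
    rw [integral_const_mul, integral_sub hS hC2, integral_add hAA hBB, integral_const_mul,
      integral_prod_mul (μ := μ) (ν := μ) (fun t => ρ t * w t * v t ^ 2) (fun t => ρ t * w t),
      integral_prod_mul (μ := μ) (ν := μ) (fun t => ρ t * w t) (fun t => ρ t * w t * v t ^ 2),
      integral_prod_mul (μ := μ) (ν := μ) (fun t => ρ t * w t * v t) (fun t => ρ t * w t * v t)]
    rw [← hPρ, ← hM₁, ← hM₂]
    field_simp
    ring
  rw [hval] at hmono
  have e2 : Pρ / Z * M₂ - M₁ ^ 2 / Z = 1 / 2 * (2 * (Pρ * M₂ - M₁ ^ 2) / Z) := by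
    field_simp
  rw [e2]
  exact mul_le_mul_of_nonneg_left hmono (by norm_num)

/-! ## §3 The variational bound: weighted Cauchy–Schwarz against the `ρw`-centred trial -/

/-- **`(∫ g v w)² ≤ G₂ · (Z/P_ρ) · 𝓔(v)`** for every measurable square-integrable CENTRED `g`
(`∫ g w = 0`) with `G₂ = ∫ g² w/ρ < ∞` and every measurable square-integrable `v`:
`∫ g v w = ∫ g (v − m) w` with `m` the `ρw`-mean of `v`; weighted Cauchy–Schwarz
`(∫ g (v − m) w)² ≤ (∫ g² w/ρ)(∫ ρ w (v − m)²)`; and `(P_ρ/Z) ∫ ρ w (v − m)² ≤ 𝓔(v)` by §2. -/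
theorem sq_inner_le_acceptance_mul_dirichlet_of_sq (hw0 : ∀ t, 0 < w t) (hwm : Measurable w)
    (hwi : Integrable w μ) (hq0 : ∀ t, 0 < q t) (hqm : Measurable q) (hqi : Integrable q μ)
    (hq1 : ∫ z, q z ∂μ = 1) {g : X → ℝ} (hgm : Measurable g)
    (hg2 : Integrable (fun t => g t ^ 2 * w t) μ) (hg0 : ∫ t, g t * w t ∂μ = 0)
    (hG : Integrable (fun t => g t ^ 2 * w t / (1 - rejCurve μ w q (w t / q t))) μ)
    {v : X → ℝ} (hvm : Measurable v) (hv2 : Integrable (fun t => v t ^ 2 * w t) μ) :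
    (∫ t, g t * v t * w t ∂μ) ^ 2
      ≤ (∫ t, g t ^ 2 * w t / (1 - rejCurve μ w q (w t / q t)) ∂μ)
          * ((∫ z, w z ∂μ) / ∫ t, (1 - rejCurve μ w q (w t / q t)) * w t ∂μ)
          * ((∫ t, v t ^ 2 * w t ∂μ) - ∫ t, v t * imhOp μ w q v t * w t ∂μ) := by
  set Z : ℝ := ∫ z, w z ∂μ with hZdef
  have hZ : 0 < Z := integral_pos_of_pos hw0 hwi hq1
  set ρ : X → ℝ := fun t => 1 - rejCurve μ w q (w t / q t) with hρdef
  obtain ⟨hρm, hρ⟩ := acc_facts hw0 hwm hwi hq0 hqm hqi hq1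
  have hw0' : ∀ t, 0 ≤ w t := fun t => (hw0 t).le
  -- moments and positivity of `P_ρ`
  obtain ⟨i0, hPρ⟩ : Integrable (fun t => ρ t * w t) μ ∧ 0 < ∫ t, ρ t * w t ∂μ :=
    acc_mul_weight_integral_pos hw0 hwm hwi hq0 hqm hqi hq1
  set Pρ : ℝ := ∫ t, ρ t * w t ∂μ with hPρdef
  have i1 : Integrable (fun t => ρ t * w t * v t) μ :=
    integrable_acc_mul_weight_mul_of_abs hw0 hwm hwi hq0 hqm hqi hq1 hvm hv2
  set M₁ : ℝ := ∫ t, ρ t * w t * v t ∂μ with hM₁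
  set m : ℝ := M₁ / Pρ with hm
  -- the centred trial `u = v − m` is square-integrable and `∫ g v w = ∫ g u w`
  have hu : Measurable (fun t => v t - m) ∧ Integrable (fun t => (v t - m) ^ 2 * w t) μ := by
    have h := sq_integrable_add_mul hw0' hwm hvm measurable_const hv2
      (by simpa using hwi : Integrable (fun t => (1 : ℝ) ^ 2 * w t) μ) (-m)
    refine ⟨hvm.sub measurable_const, h.2.congr (Eventually.of_forall fun t => ?_)⟩
    show (v t + -m * 1) ^ 2 * w t = (v t - m) ^ 2 * w t
    ring
  have igv := integrable_mul_mul_weight_of_sq hw0' hwm hgm hvm hg2 hv2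
  have igw := integrable_mul_weight_of_sq hw0' hwm hwi hgm hg2
  have hinner : ∫ t, g t * v t * w t ∂μ = ∫ t, g t * (v t - m) * w t ∂μ := by
    have e : ∀ t, g t * (v t - m) * w t = g t * v t * w t - m * (g t * w t) := fun t => by ring
    simp_rw [e]
    rw [integral_sub igv (igw.const_mul m), integral_const_mul, hg0, mul_zero, sub_zero]
  -- `U = ∫ ρ w u²`, `I = ∫ g u w`, `G₂ = ∫ g² w/ρ`; the quadratic `U − 2 s I + s² G₂ ≥ 0`
  have iU : Integrable (fun t => ρ t * w t * (v t - m) ^ 2) μ :=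
    (integrable_acc_mul_weight_mul_of_sq hw0 hwm hwi hq0 hqm hqi hq1 hu.1 hu.1 hu.2 hu.2).congr
      (Eventually.of_forall fun t => by
        show (1 - rejCurve μ w q (w t / q t)) * w t * ((v t - m) * (v t - m))
          = ρ t * w t * (v t - m) ^ 2
        rw [sq])
  have iI := integrable_mul_mul_weight_of_sq hw0' hwm hgm hu.1 hg2 hu.2
  set U : ℝ := ∫ t, ρ t * w t * (v t - m) ^ 2 ∂μ with hU
  set I : ℝ := ∫ t, g t * (v t - m) * w t ∂μ with hI
  set G₂ : ℝ := ∫ t, g t ^ 2 * w t / ρ t ∂μ with hG₂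
  have hG0 : 0 ≤ G₂ :=
    integral_nonneg fun t => div_nonneg (mul_nonneg (sq_nonneg _) (hw0' t)) (hρ t).1.le
  have key : ∀ s : ℝ, 0 ≤ G₂ * (s * s) + 2 * (-I) * s + U := by
    intro s
    have h0 : 0 ≤ ∫ t, ρ t * w t * ((v t - m) - s * (g t / ρ t)) ^ 2 ∂μ :=
      integral_nonneg fun t => mul_nonneg (mul_nonneg (hρ t).1.le (hw0' t)) (sq_nonneg _)
    have e1 : ∀ t, ρ t * w t * ((v t - m) - s * (g t / ρ t)) ^ 2
        = ρ t * w t * (v t - m) ^ 2 - 2 * s * (g t * (v t - m) * w t)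
          + s * s * (g t ^ 2 * w t / ρ t) := by
      intro t
      have hρt : ρ t ≠ 0 := (hρ t).1.ne'
      field_simp
      ring
    have i2 : Integrable (fun t => 2 * s * (g t * (v t - m) * w t)) μ := iI.const_mul _
    have i3 : Integrable (fun t => s * s * (g t ^ 2 * w t / ρ t)) μ := hG.const_mul _
    have i12 : Integrable (fun t => ρ t * w t * (v t - m) ^ 2 - 2 * s * (g t * (v t - m) * w t)) μ :=
      iU.sub i2
    have e : ∫ t, ρ t * w t * ((v t - m) - s * (g t / ρ t)) ^ 2 ∂μ = U - 2 * s * I + s * s * G₂ := by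
      simp_rw [e1]
      rw [integral_add i12 i3, integral_sub iU i2, integral_const_mul, integral_const_mul]
    rw [e] at h0
    linarith
  have hd := discrim_le_zero key
  rw [discrim] at hd
  have hIU : I ^ 2 ≤ G₂ * U := by nlinarith [hd]
  -- `(P_ρ/Z) U ≤ 𝓔(v)`: expand `U = M₂ − M₁²/P_ρ` and use §2
  have i2 : Integrable (fun t => ρ t * w t * v t ^ 2) μ :=
    (integrable_acc_mul_weight_mul_of_sq hw0 hwm hwi hq0 hqm hqi hq1 hvm hvm hv2 hv2).congr
      (Eventually.of_forall fun t => by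
        show (1 - rejCurve μ w q (w t / q t)) * w t * (v t * v t) = ρ t * w t * v t ^ 2
        rw [sq])
  set M₂ : ℝ := ∫ t, ρ t * w t * v t ^ 2 ∂μ with hM₂
  have hUeq : U = M₂ - M₁ ^ 2 / Pρ := by
    have e1 : ∀ t, ρ t * w t * (v t - m) ^ 2
        = ρ t * w t * v t ^ 2 - 2 * m * (ρ t * w t * v t) + m ^ 2 * (ρ t * w t) := fun t => by ring
    rw [hU]
    simp_rw [e1]
    have j1 : Integrable (fun t => 2 * m * (ρ t * w t * v t)) μ := i1.const_mul _
    have j2 : Integrable (fun t => m ^ 2 * (ρ t * w t)) μ := i0.const_mul _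
    have j12 : Integrable (fun t => ρ t * w t * v t ^ 2 - 2 * m * (ρ t * w t * v t)) μ := i2.sub j1
    rw [integral_add j12 j2, integral_sub i2 j1, integral_const_mul, integral_const_mul, ← hM₂, ← hM₁,
      ← hPρdef, hm]
    field_simp
    ring
  have hdir := dirichlet_ge_rankOne_of_sq hw0 hwm hwi hq0 hqm hqi hq1 hvm hv2
  rw [← hZdef] at hdir
  have hUE : Pρ / Z * U ≤ (∫ t, v t ^ 2 * w t ∂μ) - ∫ t, v t * imhOp μ w q v t * w t ∂μ := by
    have e : Pρ / Z * U = Pρ / Z * M₂ - M₁ ^ 2 / Z := by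
      rw [hUeq]
      field_simp
    rw [e]
    exact hdir
  have hγ : 0 < Pρ / Z := div_pos hPρ hZ
  rw [hinner]
  calc I ^ 2 ≤ G₂ * U := hIU
    _ = G₂ * (Z / Pρ) * (Pρ / Z * U) := by field_simp
    _ ≤ G₂ * (Z / Pρ) * ((∫ t, v t ^ 2 * w t ∂μ) - ∫ t, v t * imhOp μ w q v t * w t ∂μ) :=
        mul_le_mul_of_nonneg_left hUE (mul_nonneg hG0 (div_nonneg hZ.le hPρ.le))

/-! ## §4 The ceiling -/

/-- Setup shared by the two ceilings: the constant `B = G₂ Z/P_ρ` is nonnegative and every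
autocovariance `C_g(k) = ∫ g (Kᵏ g) w` of a square-integrable `g` is nonnegative (positivity on
`L²(w)`, `FlowSamplerSquareIntegrableMonotone`). -/
theorem acceptanceCeiling_setup_of_sq (hw0 : ∀ t, 0 < w t) (hwm : Measurable w)
    (hwi : Integrable w μ) (hq0 : ∀ t, 0 < q t) (hqm : Measurable q) (hqi : Integrable q μ)
    (hq1 : ∫ z, q z ∂μ = 1) {g : X → ℝ} (hgm : Measurable g)
    (hg2 : Integrable (fun t => g t ^ 2 * w t) μ) :
    0 ≤ (∫ t, g t ^ 2 * w t / (1 - rejCurve μ w q (w t / q t)) ∂μ)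
        * ((∫ z, w z ∂μ) / ∫ t, (1 - rejCurve μ w q (w t / q t)) * w t ∂μ) ∧
    ∀ k, 0 ≤ ∫ x, g x * ((imhOp μ w q)^[k] g) x * w x ∂μ := by
  have hw0' : ∀ t, 0 ≤ w t := fun t => (hw0 t).le
  obtain ⟨-, hρ⟩ := acc_facts hw0 hwm hwi hq0 hqm hqi hq1
  have hZ : 0 < ∫ z, w z ∂μ := integral_pos_of_pos hw0 hwi hq1
  have hPρ := (acc_mul_weight_integral_pos hw0 hwm hwi hq0 hqm hqi hq1).2
  have hG0 : 0 ≤ ∫ t, g t ^ 2 * w t / (1 - rejCurve μ w q (w t / q t)) ∂μ :=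
    integral_nonneg fun t => div_nonneg (mul_nonneg (sq_nonneg _) (hw0' t)) (hρ t).1.le
  refine ⟨mul_nonneg hG0 (div_nonneg hZ.le hPρ.le), fun k => ?_⟩
  cases k with
  | zero =>
    simp only [Function.iterate_zero, id_eq]
    exact integral_nonneg fun x => mul_nonneg (mul_self_nonneg _) (hw0' x)
  | succ k => exact (imhOp_autocov_shape_of_sq hw0 hwm hwi hq0 hqm hqi hq1 hgm hg2 k).1

/-- **EVERY PARTIAL GREEN–KUBO SUM OF A SQUARE-INTEGRABLE CENTRED OBSERVABLE IS CAPPED**: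
`Σ_{k<N} C_g(k) ≤ G₂ · Z/P_ρ` for every `N` (`C_g(k) = ∫ g (Kᵏ g) w ≥ 0` on `L²(w)`). -/
theorem imhOp_sum_range_autocov_le_acceptanceCeiling_of_sq (hw0 : ∀ t, 0 < w t)
    (hwm : Measurable w) (hwi : Integrable w μ) (hq0 : ∀ t, 0 < q t) (hqm : Measurable q)
    (hqi : Integrable q μ) (hq1 : ∫ z, q z ∂μ = 1) {g : X → ℝ} (hgm : Measurable g)
    (hg2 : Integrable (fun t => g t ^ 2 * w t) μ) (hg0 : ∫ t, g t * w t ∂μ = 0)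
    (hG : Integrable (fun t => g t ^ 2 * w t / (1 - rejCurve μ w q (w t / q t))) μ) (N : ℕ) :
    ∑ k ∈ Finset.range N, ∫ t, g t * ((imhOp μ w q)^[k] g) t * w t ∂μ
      ≤ (∫ t, g t ^ 2 * w t / (1 - rejCurve μ w q (w t / q t)) ∂μ)
          * ((∫ z, w z ∂μ) / ∫ t, (1 - rejCurve μ w q (w t / q t)) * w t ∂μ) := by
  obtain ⟨hB, hpos⟩ := acceptanceCeiling_setup_of_sq hw0 hwm hwi hq0 hqm hqi hq1 hgm hg2
  exact RevOp.sum_range_autocov_le_of_forall_sq_inner_le_dirichlet (A := fun f : X → ℝ =>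
      Measurable f ∧ Integrable (fun t => f t ^ 2 * w t) μ) (K := imhOp μ w q) (sqClass_int hw0 hwm)
    (sqClass_comb hw0 hwm) (sqClass_stab hw0 hwm hwi hq0 hqm hqi hq1)
    (sqClass_lin hw0 hwm hwi hq0 hqm hqi) (sqClass_symm hw0 hwm hwi hq0 hqm hqi hq1) ⟨hgm, hg2⟩ hpos
    hB (fun v hv => sq_inner_le_acceptance_mul_dirichlet_of_sq hw0 hwm hwi hq0 hqm hqi hq1 hgm hg2
      hg0 hG hv.1 hv.2) N

/-- **THE ACCEPTANCE-WEIGHTED CEILING ON `L²(w)`.**  `w, q > 0` measurable integrable, `∫ q = 1`,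
`Z = ∫ w`, `ρ = 1 − λ ∘ b` the per-state acceptance, `P_ρ = ∫ ρ w = ā Z`; `g` measurable with
`∫ g² w < ∞`, `∫ g w = 0`, `P = ∫ g² w > 0` and `G₂ = ∫ g² w/ρ < ∞`.  Then the normalised
autocorrelation series of `g` under `K = imhOp μ w q` IS SUMMABLE and
**`τ_int(g) ≤ (G₂ · Z/P_ρ)/P − ½ = E_{g²w}[1/ρ]/ā − ½`** — the magnetisation of lattice φ⁴
included; no boundedness, no weight bound, no a-priori summability. -/
theorem imhOp_tauInt_le_acceptanceCeiling_of_sq (hw0 : ∀ t, 0 < w t) (hwm : Measurable w)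
    (hwi : Integrable w μ) (hq0 : ∀ t, 0 < q t) (hqm : Measurable q) (hqi : Integrable q μ)
    (hq1 : ∫ z, q z ∂μ = 1) {g : X → ℝ} (hgm : Measurable g)
    (hg2 : Integrable (fun t => g t ^ 2 * w t) μ) (hg0 : ∫ t, g t * w t ∂μ = 0)
    (hP : 0 < ∫ t, g t ^ 2 * w t ∂μ)
    (hG : Integrable (fun t => g t ^ 2 * w t / (1 - rejCurve μ w q (w t / q t))) μ) :
    (Summable fun n => (∫ t, g t * ((imhOp μ w q)^[n + 1] g) t * w t ∂μ)
      / ∫ t, g t ^ 2 * w t ∂μ) ∧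
    tauInt (fun n => (∫ t, g t * ((imhOp μ w q)^[n] g) t * w t ∂μ) / ∫ t, g t ^ 2 * w t ∂μ)
      ≤ (∫ t, g t ^ 2 * w t / (1 - rejCurve μ w q (w t / q t)) ∂μ)
          * ((∫ z, w z ∂μ) / ∫ t, (1 - rejCurve μ w q (w t / q t)) * w t ∂μ)
          / (∫ t, g t ^ 2 * w t ∂μ) - 1 / 2 := by
  obtain ⟨hB, hpos⟩ := acceptanceCeiling_setup_of_sq hw0 hwm hwi hq0 hqm hqi hq1 hgm hg2
  exact RevOp.tauInt_le_of_forall_sq_inner_le_dirichlet_of_nonneg (A := fun f : X → ℝ =>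
      Measurable f ∧ Integrable (fun t => f t ^ 2 * w t) μ) (K := imhOp μ w q) (sqClass_int hw0 hwm)
    (sqClass_comb hw0 hwm) (sqClass_stab hw0 hwm hwi hq0 hqm hqi hq1)
    (sqClass_lin hw0 hwm hwi hq0 hqm hqi) (sqClass_symm hw0 hwm hwi hq0 hqm hqi hq1) ⟨hgm, hg2⟩ hP
    hpos hB fun v hv => sq_inner_le_acceptance_mul_dirichlet_of_sq hw0 hwm hwi hq0 hqm hqi hq1 hgm
      hg2 hg0 hG hv.1 hv.2

end General

end Summit.Ventures.LatticeQCDFlow.Exactness
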